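import Mathlib
import Literature.MathematicalPhysics.QuantumLattice.WilsonDiracAP
import Summits.QuantumFields.QCD.Theorems.QuarksAsStableActionCriticalLineDiamagnetismStubCellGainCore
import Summits.QuantumFields.QCD.Theorems.QuarksAsStableActionCriticalLineDiamagnetismStubBlochLatticeSum
import Summits.QuantumFields.QCD.Theorems.WilsonQuarkChessboardFlatCellOptimalStubFreeDetFormulaAllN
import Summits.QuantumFields.QCD.Theorems.WilsonQuarkChessboardFlatCellOptimalStubFreeBlochBlocksAllN
import Summits.QuantumFields.QCD.Theorems.WilsonQuarkChessboardFlatCellOptimalStubCellDetFactorisationAllN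
import Summits.QuantumFields.QCD.Theorems.WilsonQuarkChessboardFlatCellOptimalStubTangentDeltaBAllN
import Summits.QuantumFields.QCD.Theorems.WilsonQuarkChessboardFlatCellOptimalStubTilingCellDataAllN
import Summits.QuantumFields.QCD.Theorems.WilsonQuarkChessboardFlatCellOptimalStubCellGainOfGaugedAllN
import Summits.QuantumFields.QCD.Theorems.WilsonQuarkChessboardFlatCellOptimalStubBlockEstimateDimFree
import Summits.QuantumFields.QCD.Theorems.WilsonQuarkChessboardFlatCellOptimalStubHessianMarginAssemblyAuxAllN
import Summits.QuantumFields.QCD.Theorems.WilsonQuarkChessboardFlatCellOptimalStubOneLoopMarginAllN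

/-!
# The one-cell gain in tiling form, every colour number `N`, every `M ≥ 2`, no additive slack
(helper for crux stmt-QuantumFields-9307 `FlatCellOptimal`, line `registered`, stub
`stub_localNormGain_of` (G4 transport), sub-goal `stub_cellGainCoreAllN` — the `Fin 3 ↦ Fin N`,
SLACK-FREE (`K_g = 0`), DIMENSION-FREE port of the sibling crux stmt-QuantumFields-9734's assembly
`…CriticalLineDiamagnetismStubCellGainCore`, wave 14)

What.  For every `C_B ≥ 0` there are `N`-free constants `η_g, c_g, ε > 0` such that for EVERY colour
number `N`, EVERY half-side `M ≥ 2` (torus `(ℤ/2M)⁴`), every mass `|m| ≤ ε`, the period-2 reflection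
tiling `tile` (given by its defining equation), every `U(N)` field `W` and corner `c` whose `32`
closed-cell links have deficit `N − Re tr W_e ≤ η_g` and which is in a good gauge
(`F_cell(W) ≤ C_B · S_cell(W)`, total cell-link deficit against total cell-plaquette deficit):
`‖det D_AP[tile_c W]‖ ≤ exp(0 − c_g M⁴ S_cell(W)) · ‖det D_AP[𝟙]‖`
(`stub_cellGainCoreAllN`; `D_AP[X]` the `r = 1` Wilson–Dirac operator of the seam-twisted field).  This
is literally the hypothesis `hCore` consumed by the landed all-`N` glue chain
`stub_cellRegaugeAllN → stub_cellGainTilingGlueAllN → stub_cellGainOfGaugedAllN` (`K = 0`).  Compared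
with the sibling (`N = 3`, `∃ M₀`, `exp(K_g − …)`): no threshold `M₀`, no additive constant, and the
link threshold `η_g` does not depend on `N`.

How (the sibling assembly, ported to the all-`N` inputs landed for this crux).
* (1) phases `ω = e^{iπ/2M}·1`, `ζ_k(μ) = e^{iπk_μ/M}·1 ∈ U(N)`
  (`FreeDetFormula.phase_mem_unitaryGroup`, `CellGainCoreAllN.exists_zeta`), `ζ_k(μ) ω = e^{iθ_{k,μ}}·1`
  (`HessianMarginAllN.coe_zeta_mul_omega`).
* (2) Bloch factorisation `det D_AP[tile_c W] = ∏_k det B_k`, `det D_AP[𝟙] = ∏_k det B⁰_k`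
  (`stub_cellDetFactorisationAllN`).
* (3) coercivity of the free blocks `B⁰_k` with `h_min(k) = min_s h_k(s) > 0`
  (`stub_freeBlochBlocksAllN`, `CellGainCore.symbol_pos`).
* (4) `Δ_k = B_k − B⁰_k`: `‖Δ_k‖_F² ≤ 64 F'`, `Σ‖Δ_k v‖² ≤ 256 a Σ‖v‖²` (`stub_tangentDeltaBAllN`, `N`-free
  constants), `a ≤ η_g` the maximal and `F' ≤ 2 F_cell` the total link deficit of the cell field `W_c`
  (`stub_tilingCellDataAllN`).
* (5) the DIMENSION-FREE block estimate `‖det B_k‖ ≤ ‖det B⁰_k‖ exp(q_k + 4 Φ √α · h_min(k)^{-3/2})`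
  (`stub_blockEstimateDimFree`, from the dimension-free log-determinant bounds G1), so that the error
  coefficient is `E = 4 · 64 F' · √(256 a) = 4096 √a F'` — no `card ι = 64 N` (`CellGainCoreAllN.err_eq`);
  this is what makes `η_g` independent of `N`.
* (6)–(7) product → sum (`CellGainCore.norm_prod_le_exp`) and the lattice sum `Σ_k h_min(k)^{-3/2} ≤ C_Σ M⁴`
  (`stub_blochLatticeSum`, every `M`).
* (8)–(9) the slack-free all-`N` one-loop margin P6 (`stub_oneLoopMarginAllN`, every `M ≥ 2`):
  `Σ_k q_k ≤ −c_q M⁴ S + C_q √η_g M⁴ F`; with `F ≤ C_B S` and `η_g` small (`CellGainCore.exists_eta`) the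
  exponent is `≤ 0 − (c_q/2) M⁴ S` (`CellGainCore.exponent_le` with `K_q = 0`, `C₁ = 4096`).
Constants: `c_g = c_q/2`, `ε = min ε_q ε_Σ`, `η_g = min η₀ (c_q/(2A+1))²`,
`A = (max C_q 0 + 8192 max C_Σ 0) · max C_B 0`.
References: Montvay–Münster, *Quantum Fields on a Lattice* §4.2 (free Wilson fermions, twisted boundary
conditions); E. Seiler, LNP 159 (1982) Ch. 3 (determinant bounds).  The P6 input rests on
interval-arithmetic certificates (computational lane).  Pure theorem file (no `def`s).
-/

noncomputable section

open scoped BigOperators Classical Matrix ComplexConjugate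
open Finset
open Literature.MathematicalPhysics.QuantumLattice Literature.MathematicalPhysics.QuantumFieldTheory
  Literature.Probability.LatticeModels

namespace Summit.QuantumFields.QCD.Cruxes.FlatCellOptimal.CellGain

open Summit.QuantumFields.QCD.Cruxes.CriticalLineDiamagnetism.ChessboardCellGain (stub_blochLatticeSum)
open Summit.QuantumFields.QCD.Cruxes.CriticalLineDiamagnetism.ChessboardCellGain.CellGainCore
  (symbol_pos exists_eta exponent_le norm_prod_le_exp)
open Summit.QuantumFields.QCD.Cruxes.FlatCellOptimal.HessianMargin.HessianMarginAllN (coe_zeta_mul_omega)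
open Summit.QuantumFields.QCD.Cruxes.FlatCellOptimal.FreeBlocks (stub_freeBlochBlocksAllN)
open Summit.QuantumFields.QCD.Cruxes.FlatCellOptimal.FreeBlocks.FreeDetFormula
  (exp_mul_I_smul_one_mem phase_mem_unitaryGroup)
open Summit.QuantumFields.QCD.Cruxes.FlatCellOptimal.CellDet (stub_cellDetFactorisationAllN)
open Summit.QuantumFields.QCD.Cruxes.FlatCellOptimal.TangentDelta (stub_tangentDeltaBAllN)
open Summit.QuantumFields.QCD.Cruxes.FlatCellOptimal.TilingData (stub_tilingCellDataAllN)
open Summit.QuantumFields.QCD.Cruxes.FlatCellOptimal.OneLoop (stub_oneLoopMarginAllN)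

namespace CellGainCoreAllN

/-! ### Phases (`N` colours) -/

/-- The Bloch phases `ζ_k(μ) = e^{iπ k_μ/M}·1 ∈ U(N)` exist (every `N`). -/
theorem exists_zeta (N M : ℕ) : ∃ ζ : (Fin 4 → Fin M) → Fin 4 → Matrix.unitaryGroup (Fin N) ℂ,
    ∀ k μ, ((ζ k μ : Matrix.unitaryGroup (Fin N) ℂ) : Matrix (Fin N) (Fin N) ℂ) =
      Complex.exp (Real.pi * Complex.I * ((k μ : ℕ) : ℂ) / (M : ℂ)) •
        (1 : Matrix (Fin N) (Fin N) ℂ) := by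
  -- adapted from the sibling `CellGainCore.exists_zeta` (`Fin 3 ↦ Fin N`)
  have h : ∀ (k : Fin 4 → Fin M) (μ : Fin 4), Real.pi * Complex.I * ((k μ : ℕ) : ℂ) / (M : ℂ) =
      ↑(Real.pi * ((k μ : ℕ) : ℝ) / M : ℝ) * Complex.I := by
    intro k μ; push_cast; ring
  refine ⟨fun k μ => ⟨Complex.exp (Real.pi * Complex.I * ((k μ : ℕ) : ℂ) / (M : ℂ)) • 1, ?_⟩,
    fun k μ => rfl⟩
  rw [h]
  exact exp_mul_I_smul_one_mem _

/-! ### Real arithmetic -/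

/-- The dimension-free error coefficient: `4 · (64 F') · √(256 a) = 4096 · (√a · F')`. -/
theorem err_eq (F a : ℝ) : 4 * (64 * F) * Real.sqrt (256 * a) = 4096 * (Real.sqrt a * F) := by
  have h256 : Real.sqrt (256 : ℝ) = 16 := by
    rw [show (256 : ℝ) = 16 ^ 2 by norm_num, Real.sqrt_sq (by norm_num)]
  rw [Real.sqrt_mul (by norm_num : (0 : ℝ) ≤ 256) a, h256]
  ring

end CellGainCoreAllN

open CellGainCoreAllN

/-- **Sub-goal `stub_cellGainCoreAllN` (G4, wave 14) — the one-cell gain in tiling form for good-gauge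
cells, every `N`, every `M ≥ 2`, `K_g = 0`.**  For every `C_B ≥ 0` there are `η_g, c_g, ε > 0` (`N`-free)
such that for all `N`, all `M ≥ 2`, `|m| ≤ ε`, the tiling `tile` (defining equation), every `U(N)` field
`W` on `(ℤ/2M)⁴` and corner `c` with `η_g`-small closed-cell links in a good gauge
(`F_cell(W) ≤ C_B S_cell(W)`):
`‖det D_AP[tile_c W]‖ ≤ exp(0 − c_g M⁴ S_cell(W)) ‖det D_AP[𝟙]‖`.  See the module docstring. -/
theorem stub_cellGainCoreAllN : ∀ (CB : ℝ), 0 ≤ CB → ∃ ηg cg ε : ℝ, 0 < ηg ∧ 0 < cg ∧ 0 < ε ∧ ∀ (N M : ℕ) [NeZero M], 2 ≤ M → ∀ (m : ℝ), |m| ≤ ε → ∀ (tile : Site 4 (2 * M) → GaugeConfig 4 (2 * M) (Matrix.unitaryGroup (Fin N) ℂ) → GaugeConfig 4 (2 * M) (Matrix.unitaryGroup (Fin N) ℂ)), (∀ (c : Site 4 (2 * M)) (V : GaugeConfig 4 (2 * M) (Matrix.unitaryGroup (Fin N) ℂ)) (e : Edge 4 (2 * M)), tile c V e = if (e.1 e.2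 - c e.2).val % 2 = 0 then V (fun ν => c ν + (((e.1 ν - c ν).val % 2 : ℕ) : ZMod (2 * M)), e.2) else (V (fun ν => c ν + (((Site.shift e.1 e.2 ν - c ν).val % 2 : ℕ) : ZMod (2 * M)), e.2))⁻¹) → ∀ (W : GaugeConfig 4 (2 * M) (Matrix.unitaryGroup (Fin N) ℂ)) (c : Site 4 (2 * M)), (∀ e : Edge 4 (2 * M), ((∀ ν, (e.1 ν - c ν).val ≤ 1) ∧ (e.1 e.2 - c e.2).val = 0) → (N : ℝ) - ((W e : Matrix.unitaryGroup (Fin N) ℂ) : Matrix (Fin N) (Fin N) ℂ).trace.re ≤ ηg) → (∑ e ∈ Finset.univ.filter (fun e : Edge 4 (2 * M) => (∀ ν, (e.1 ν - c ν).val ≤ 1) ∧ (e.1 e.2 - c e.2).val = 0), ((N : ℝ) - ((W e : Matrix.unitaryGroup (Fin N) ℂ) : Matrix (Fin N) (Fin N) ℂ).trace.re)) ≤ CB * ∑ p ∈ Finset.univ.filter (fun p : Plaquette 4 (2 * M) => p.1 p.2.1.1 = c p.2.1.1 ∧ p.1 p.2.1.2 = c p.2.1.2 ∧ ∀ ν,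 ν ≠ p.2.1.1 → ν ≠ p.2.1.2 → (p.1 ν = c ν ∨ p.1 ν = c ν + 1)), ((N : ℝ) - (unitaryFundamentalRep (Fin N) ℂ (plaquetteHolonomy W p.1 p.2.1.1 p.2.1.2)).trace.re) → ‖(wilsonDirac (unitaryFundamentalRep (Fin N) ℂ) (fun e => if (e.1 e.2).val + 1 = 2 * M then -(tile c W e) else tile c W e) m 1).det‖ ≤ Real.exp (0 - cg * (M : ℝ) ^ 4 * ∑ p ∈ Finset.univ.filter (fun p : Plaquette 4 (2 * M) => p.1 p.2.1.1 = c p.2.1.1 ∧ p.1 p.2.1.2 = c p.2.1.2 ∧ ∀ ν, ν ≠ p.2.1.1 → ν ≠ p.2.1.2 → (p.1 ν = c ν ∨ p.1 ν = c ν + 1)), ((N : ℝ) - (unitaryFundamentalRep (Fin N) ℂ (plaquetteHolonomy W p.1 p.2.1.1 p.2.1.2)).trace.re)) * ‖(wilsonDirac (unitaryFundamentalRep (Fin N) ℂ) (fun e : Edge 4 (2 * M) => if (e.1 e.2).val + 1 = 2 * M then (-1 : Matrix.unitaryGroup (Fin N) ℂ) else 1) m 1).det‖ := by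
  intro CB hCB
  obtain ⟨cq, Cq, εq, η₀, hcq, hεq, hη₀, hP⟩ := stub_oneLoopMarginAllN
  obtain ⟨CS, εS, hεS, hLS⟩ := stub_blochLatticeSum
  -- constants (`C₁ = 4096 = 4 · 64 · 16`, dimension-free)
  have hC₁ : (0 : ℝ) ≤ 4096 := by norm_num
  obtain ⟨η, hη, hηη₀, hkey⟩ :=
    exists_eta (A := (max Cq 0 + 2 * 4096 * max CS 0) * max CB 0) (by positivity) hcq hη₀
  refine ⟨η, cq / 2, min εq εS, hη, by positivity, lt_min hεq hεS, ?_⟩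
  intro N M _ hM m hm tile htile V c hlinks hgauge
  have hmq : |m| ≤ εq := hm.trans (min_le_left _ _)
  have hmS : |m| ≤ εS := hm.trans (min_le_right _ _)
  -- the two cell sums
  set S : ℝ := ∑ p ∈ univ.filter (fun p : Plaquette 4 (2 * M) => p.1 p.2.1.1 = c p.2.1.1 ∧
      p.1 p.2.1.2 = c p.2.1.2 ∧ ∀ ν, ν ≠ p.2.1.1 → ν ≠ p.2.1.2 → (p.1 ν = c ν ∨ p.1 ν = c ν + 1)),
    ((N : ℝ) - (unitaryFundamentalRep (Fin N) ℂ (plaquetteHolonomy V p.1 p.2.1.1 p.2.1.2)).trace.re)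
  set F : ℝ := ∑ e ∈ univ.filter (fun e : Edge 4 (2 * M) => (∀ ν, (e.1 ν - c ν).val ≤ 1) ∧
      (e.1 e.2 - c e.2).val = 0),
    ((N : ℝ) - ((V e : Matrix.unitaryGroup (Fin N) ℂ) : Matrix (Fin N) (Fin N) ℂ).trace.re)
  have hS0 : 0 ≤ S := Finset.sum_nonneg fun p _ => CellGainOfGauged.deficit_nonneg _
  have hF0 : 0 ≤ F := Finset.sum_nonneg fun e _ => CellGainOfGauged.deficit_nonneg _
  -- (1) the phases `ω`, `ζ_k`
  obtain ⟨ω, hω⟩ : ∃ ω : Matrix.unitaryGroup (Fin N) ℂ, (ω : Matrix (Fin N) (Fin N) ℂ) =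
      Complex.exp (↑(Real.pi / (2 * M : ℕ)) * Complex.I) • (1 : Matrix (Fin N) (Fin N) ℂ) :=
    ⟨⟨_, phase_mem_unitaryGroup (2 * M)⟩, rfl⟩
  obtain ⟨ζ, hζ⟩ := exists_zeta N M
  set θ : (Fin 4 → Fin M) → Fin 4 → ℝ := fun k μ =>
    Real.pi * ((k μ : ℕ) : ℝ) / M + Real.pi / (2 * M) with hθ_def
  have hu : ∀ (k : Fin 4 → Fin M) (μ : Fin 4),
      (((fun ν => ζ k ν * ω) μ : Matrix.unitaryGroup (Fin N) ℂ) : Matrix (Fin N) (Fin N) ℂ) =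
        Complex.exp (↑(θ k μ) * Complex.I) • (1 : Matrix (Fin N) (Fin N) ℂ) :=
    fun k μ => coe_zeta_mul_omega hω (hζ k μ)
  -- the cell field on the `2⁴`-torus and the blocks
  set Wc : GaugeConfig 4 2 (Matrix.unitaryGroup (Fin N) ℂ) := fun e =>
    tile c V (fun ν => c ν + (((e.1 ν).val : ℕ) : ZMod (2 * M)), e.2) with hWc_def
  set B0 : (Fin 4 → Fin M) →
      Matrix (TorusSite 4 2 × Fin N × Fin 4) (TorusSite 4 2 × Fin N × Fin 4) ℂ := fun k =>
    wilsonDirac (unitaryFundamentalRep (Fin N) ℂ) (fun e : Edge 4 2 => ζ k e.2 * ω) m 1 with hB0_def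
  set B1 : (Fin 4 → Fin M) →
      Matrix (TorusSite 4 2 × Fin N × Fin 4) (TorusSite 4 2 × Fin N × Fin 4) ℂ := fun k =>
    wilsonDirac (unitaryFundamentalRep (Fin N) ℂ) (fun e : Edge 4 2 => ζ k e.2 * ω * Wc e) m 1
    with hB1_def
  -- (3) the free symbol at the Bloch angles, its minimisers, and the coercivity of the free blocks
  set hh : (Fin 4 → Fin M) → (Fin 4 → ZMod 2) → ℝ := fun k s =>
    (m + ∑ μ : Fin 4, (1 - Real.cos (Real.pi * ((s μ).val : ℝ) + θ k μ))) ^ 2 +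
      ∑ μ : Fin 4, Real.sin (Real.pi * ((s μ).val : ℝ) + θ k μ) ^ 2 with hhh_def
  have hpos : ∀ k s, 0 < hh k s := fun k s => symbol_pos m k s
  have hmin : ∀ k, ∃ s₁, ∀ s, hh k s₁ ≤ hh k s := fun k => by
    obtain ⟨s₁, -, h⟩ := Finset.exists_min_image Finset.univ (hh k) Finset.univ_nonempty
    exact ⟨s₁, fun s => h s (Finset.mem_univ s)⟩
  choose s₀ hs₀ using hmin
  have hcoer : ∀ (k : Fin 4 → Fin M) (v : TorusSite 4 2 × Fin N × Fin 4 → ℂ),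
      hh k (s₀ k) * ∑ i, ‖v i‖ ^ 2 ≤ ∑ i, ‖((B0 k).mulVec v) i‖ ^ 2 := fun k =>
    (stub_freeBlochBlocksAllN N (θ k) m (fun ν => ζ k ν * ω) (hu k) (B0 k) (hh k) rfl
      (fun _ => rfl)).2 (hh k (s₀ k)) (hs₀ k)
  -- (4) the tiling cell data and the maximal link deficit `a2`
  obtain ⟨hWlink, hWsum⟩ : (∀ e : Edge 4 2, ∃ e' : Edge 4 (2 * M),
      ((∀ ν, (e'.1 ν - c ν).val ≤ 1) ∧ (e'.1 e'.2 - c e'.2).val = 0) ∧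
        ((Wc e : Matrix.unitaryGroup (Fin N) ℂ) : Matrix (Fin N) (Fin N) ℂ).trace.re =
          ((V e' : Matrix.unitaryGroup (Fin N) ℂ) : Matrix (Fin N) (Fin N) ℂ).trace.re) ∧
      ∑ e : Edge 4 2, ((N : ℝ) - ((Wc e : Matrix.unitaryGroup (Fin N) ℂ) :
        Matrix (Fin N) (Fin N) ℂ).trace.re) ≤ 2 * F :=
    stub_tilingCellDataAllN N M tile htile V c Wc (fun _ => rfl)
  obtain ⟨e₀, -, he₀⟩ := Finset.exists_max_image (univ : Finset (Edge 4 2)) (fun e =>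
    (N : ℝ) - ((Wc e : Matrix.unitaryGroup (Fin N) ℂ) : Matrix (Fin N) (Fin N) ℂ).trace.re) univ_nonempty
  set a2 : ℝ := (N : ℝ) - ((Wc e₀ : Matrix.unitaryGroup (Fin N) ℂ) : Matrix (Fin N) (Fin N) ℂ).trace.re
    with ha2_def
  have hWa : ∀ e, (N : ℝ) - ((Wc e : Matrix.unitaryGroup (Fin N) ℂ) :
      Matrix (Fin N) (Fin N) ℂ).trace.re ≤ a2 := fun e => he₀ e (mem_univ e)
  have ha2 : 0 ≤ a2 := CellGainOfGauged.deficit_nonneg _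
  have ha2η : a2 ≤ η := by
    obtain ⟨e', he', htr⟩ := hWlink e₀
    rw [ha2_def, htr]
    exact hlinks e' he'
  set F' : ℝ := ∑ e : Edge 4 2,
    ((N : ℝ) - ((Wc e : Matrix.unitaryGroup (Fin N) ℂ) : Matrix (Fin N) (Fin N) ℂ).trace.re) with hF'_def
  have ha2F' : a2 ≤ F' :=
    Finset.single_le_sum (f := fun e => (N : ℝ) - ((Wc e : Matrix.unitaryGroup (Fin N) ℂ) :
      Matrix (Fin N) (Fin N) ℂ).trace.re) (fun e _ => CellGainOfGauged.deficit_nonneg _) (mem_univ e₀)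
  have hF'0 : 0 ≤ F' := ha2.trans ha2F'
  have hΔk : ∀ k, (∑ i, ∑ j, ‖(B1 k - B0 k) i j‖ ^ 2 ≤ 64 * F') ∧
      ∀ v : TorusSite 4 2 × Fin N × Fin 4 → ℂ,
        ∑ i, ‖((B1 k - B0 k).mulVec v) i‖ ^ 2 ≤ 256 * a2 * ∑ i, ‖v i‖ ^ 2 := fun k => by
    obtain ⟨hF, hop⟩ := stub_tangentDeltaBAllN N 2 m (fun ν => ζ k ν * ω) Wc (B1 k - B0 k) rfl
    exact ⟨hF, hop a2 hWa⟩
  -- (5) the dimension-free block estimate, block by block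
  set q : (Fin 4 → Fin M) → ℝ := fun k => ((B0 k)⁻¹ * (B1 k - B0 k)).trace.re -
    (((B0 k)⁻¹ * (B1 k - B0 k)) * ((B0 k)⁻¹ * (B1 k - B0 k))).trace.re / 2 with hq_def
  set t : (Fin 4 → Fin M) → ℝ := fun k => Real.sqrt (hh k (s₀ k)) / hh k (s₀ k) ^ 2 with ht_def
  set E : ℝ := 4 * (64 * F') * Real.sqrt (256 * a2) with hE_def
  have hΦ : 0 ≤ 64 * F' := mul_nonneg (by norm_num) hF'0
  have hα : 0 ≤ 256 * a2 := mul_nonneg (by norm_num) ha2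
  have hE0 : 0 ≤ E := mul_nonneg (mul_nonneg (by norm_num) hΦ) (Real.sqrt_nonneg _)
  have hblock : ∀ k, ‖(B1 k).det‖ ≤ ‖(B0 k).det‖ * Real.exp (q k + E * t k) := by
    intro k
    have hk := stub_blockEstimateDimFree (B0 k) (B1 k - B0 k) (hh k (s₀ k)) (64 * F') (256 * a2)
      (hpos k _) hΦ hα (hcoer k) (hΔk k).1 (hΔk k).2
    rw [add_sub_cancel] at hk
    exact hk
  -- (7) the lattice sum
  have ht : ∑ k, t k ≤ CS * (M : ℝ) ^ 4 :=
    calc ∑ k, t k ≤ ∑ k : Fin 4 → Fin M, ∑ s : Fin 4 → ZMod 2, Real.sqrt (hh k s) / hh k s ^ 2 :=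
          Finset.sum_le_sum fun k _ => Finset.single_le_sum
            (f := fun s => Real.sqrt (hh k s) / hh k s ^ 2)
            (fun s _ => div_nonneg (Real.sqrt_nonneg _) (sq_nonneg _)) (mem_univ (s₀ k))
      _ ≤ CS * (M : ℝ) ^ 4 := hLS M m hmS
  -- (8) the error algebra (dimension-free)
  have hE : E ≤ 4096 * (Real.sqrt a2 * F') := (err_eq F' a2).le
  -- (9) the slack-free one-loop margin (P6, every `N`, every `M ≥ 2`)
  have hq : ∑ k, q k ≤ -(cq * (M : ℝ) ^ 4 * S) + Cq * Real.sqrt η * (M : ℝ) ^ 4 * F :=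
    hP N M hM m hmq V c ω ζ hω hζ η hηη₀ hlinks tile Wc B0 B1 htile (fun _ => rfl) (fun _ => rfl)
      (fun _ => rfl)
  have hq' : ∑ k, q k ≤ 0 - cq * (M : ℝ) ^ 4 * S + Cq * Real.sqrt η * (M : ℝ) ^ 4 * F :=
    hq.trans_eq (by ring)
  -- (10) combine
  have hexp : ∑ k, (q k + E * t k) ≤ 0 - cq / 2 * (M : ℝ) ^ 4 * S := by
    rw [Finset.sum_add_distrib, ← Finset.mul_sum]
    exact exponent_le hq' ht hE hE0 ha2η ha2 ha2F' hWsum hgauge hS0 hF0 (pow_nonneg (Nat.cast_nonneg M) 4)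
      hC₁ hkey
  -- (2) + (6) factorisation and product → sum
  obtain ⟨hT, hT₀⟩ : (wilsonDirac (unitaryFundamentalRep (Fin N) ℂ)
      (fun e => if (e.1 e.2).val + 1 = 2 * M then -(tile c V e) else tile c V e) m 1).det =
        ∏ k : Fin 4 → Fin M, (B1 k).det ∧
      (wilsonDirac (unitaryFundamentalRep (Fin N) ℂ) (fun e : Edge 4 (2 * M) =>
        if (e.1 e.2).val + 1 = 2 * M then (-1 : Matrix.unitaryGroup (Fin N) ℂ) else 1) m 1).det =
        ∏ k : Fin 4 → Fin M, (B0 k).det :=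
    stub_cellDetFactorisationAllN N M m
      (fun X => (wilsonDirac (unitaryFundamentalRep (Fin N) ℂ)
        (fun e => if (e.1 e.2).val + 1 = 2 * M then -X e else X e) m 1).det)
      tile (fun _ => rfl) htile V c ω ζ hω hζ Wc (fun _ => rfl)
  have key : ‖∏ k : Fin 4 → Fin M, (B1 k).det‖ ≤
      Real.exp (0 - cq / 2 * (M : ℝ) ^ 4 * S) * ‖∏ k : Fin 4 → Fin M, (B0 k).det‖ :=
    (norm_prod_le_exp hblock).trans
      (mul_le_mul_of_nonneg_right (Real.exp_le_exp.2 hexp) (norm_nonneg _))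
  rw [← hT, ← hT₀] at key
  exact key

end Summit.QuantumFields.QCD.Cruxes.FlatCellOptimal.CellGain

end
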